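import Summits.CriticalPhenomena.SAWScalingLimit.Theses.SAWEdgeOfPositiveType

/-!
# Route `SAWEdgeOfPositiveType`: the assembly frame

Item `stmt-CriticalPhenomena-13971` (`Assembly : ConvexMetricTriangle → AveragedTubeMass →
ConvexMetricUpgrade → AnnularMassDecay → SurgeryReduction → TightOfShellCrossing →
SubseqIdentification → TightIdentificationCriterion → SAWScalingLimit`).

Pure logic: the item was restated (route rev 2) to the exact type of the route's deciding theorem
`Theses.SAWEdgeOfPositiveType.closes`, so the proof is that theorem. Spelled out:
`ConvexMetricUpgrade` applied to `ConvexMetricTriangle` and `AveragedTubeMass` gives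
`TubeLowerBound`; `SurgeryReduction` applied to `AnnularMassDecay` and `TubeLowerBound` gives
`ShellCrossingBound`; `TightOfShellCrossing` turns it into `EventualTight`; and for each Dobrushin
domain `D` with an endpoint approximation `(a, b)` the `δ₀`-tightness produced by `EventualTight`
together with `SubseqIdentification` at `(D, a, b)` feeds `TightIdentificationCriterion`, whose
conclusion is `ConvergesInLawToSLE (8/3) D …`, i.e. `SAWScalingLimit` unfolded at `(D, a, b)`.

No named fact is used; axioms are the standard three.
-/

namespace Summit.CriticalPhenomena.SAWScalingLimit.Theorems

/-- **Item `stmt-CriticalPhenomena-13971` (`SAWEdgeOfPositiveType.Assembly`):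
`ConvexMetricTriangle → AveragedTubeMass → ConvexMetricUpgrade → AnnularMassDecay →
SurgeryReduction → TightOfShellCrossing → SubseqIdentification → TightIdentificationCriterion →
SAWScalingLimit`.** Modus ponens three times (`ConvexMetricUpgrade` on the two cruxes gives
`TubeLowerBound`, `SurgeryReduction` with `AnnularMassDecay` gives `ShellCrossingBound`,
`TightOfShellCrossing` gives `EventualTight`), then for each `(D, a, b)` with `IsEndpointApprox`
the germ criterion `TightIdentificationCriterion` fed with the `δ₀`-tightness and
`SubseqIdentification`. This is literally the route's deciding theorem `closes`. [folklore] -/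
theorem edgeOfPositiveType_assembly_proof : Theses.SAWEdgeOfPositiveType.Assembly := by
  unfold Theses.SAWEdgeOfPositiveType.Assembly
  intro hCMT hAvg hUp hAMD hSurg hTight hI hCrit
  exact Theses.SAWEdgeOfPositiveType.closes hCMT hAvg hUp hAMD hSurg hTight hI hCrit

end Summit.CriticalPhenomena.SAWScalingLimit.Theorems
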